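/-
Copyright (c) 2026 the pub-hodgecm-mathlib formalisation cell (harness21).  Prover seat hodgecm-mathlib-K2E1-p16 (g4), Track B ∕ K2-LIT, h413 = `stmt-HodgeConjecture-24833`,
R90-TF section S8 «ContSpec-n½», socket (E) :276 (N₃) row per `K_∞`-type, S8 dealer R90-CS-plan (g4) S8-R254 (8) ∕ S8-R256 (5) (E1-PLANCHEREL BODY, joint census
`R90/S8/CENSUS-PlancherelBody-bricks.K2E1-p16-F0P2-p10.md`, brick PB-0′): THE τ-CUT DENSITY — the τ-cut block `Sc ⊓ N_τ` is the closed span of the `K_∞`-type projections of the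
generating wave packets, and the `K_∞`-type projection of a wave packet is the wave packet of the averaged section.  Mathlib + ★ S8 files + ★ Literature (compact-group projectors).
-/
import Summits.HodgeConjecture.HodgeConjecture.Theorems.R90S8ResGIsotypicArchLevelBridgeU3        -- ★ (K2E1-p14): brings ★ `restrict_archInfUnitaryOne_apply_mem_resGBlock`, ★ `starProjection_isotypicComponent_mem'`, ★ G-DEFS `resGBlock`, `resGBlock_def`, `isClosed_resGBlock`
import Summits.HodgeConjecture.HodgeConjecture.Theorems.R90S8ResGMidAtomGenKTypeProjectionClassU3   -- ★ p865162∕p865022 (LH4-p10): `coeFn_charProj_rightRegular_ae_eq` (class bridge), `eisensteinSeriesU_flatSectionU_rightAverage`, `mem_chiSectionSpacePair_rightAverage`, `continuous_rightAverage`; brings ★ `Schur.charProj`, ★ `integral_mul_comp_congr_ae`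
import Summits.HodgeConjecture.HodgeConjecture.Theorems.R90S8TubeSeedOperatorLettersU3               -- ★ (K2E2-p12): `exists_bound_of_isChiSectionPair_of_isUnitary` (continuous pair sections of unitary data are bounded)
import Summits.HodgeConjecture.HodgeConjecture.Theorems.K2E1ChiPseudoEisensteinRadialCMTwo           -- ★ C2 (generic): `comp_borelHeight_mul_eq_flatSectionU`, `continuous_twistedCoeff`, `exists_bound_twistedCoeff` (a wave packet is the Eisenstein series of a flat section at `z = 3`)
import Literature.NumberTheory.Automorphic.CompactGroupCharacterProjectionIsotypic                  -- ★ `charProj_eq_starProjection_isotypicComponent` (Bröcker–tom Dieck III (5.10))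
import HarnessLib

/-!
# R90-TF · S8 «ContSpec-n½» — `R90S8ResGBlockTauCutDensityU3`: THE τ-CUT DENSITY (brick PB-0′ of the E1-Plancherel body)

Cell `hodgecm-mathlib`, crux H413 (`stmt-HodgeConjecture-24833`, lane `--supports … --as helper`), route of record `HCCMUnconditional`; R90-TF section S8, socket (E) `sock_S8_res_exhaustion_le_closure`
(B ED. 7 :276), (N₃) row per `K_∞`-type through ★ `hNblk_of_tauCuts`: the τ-cut letters are stated at the τ-CUT BLOCK `Sc ⊓ N_τ` (`Sc = resGBlock L μ (ι_f Kf) 1 χ₁ χ₂` the block of record,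
`N_τ = (ρ.isotypicComponent τ).toSubmodule`, `ρ = R ∘ ι_∞|_{K_∞}`, `K_∞ = U(J₃)(L⁺⊗ℝ) ∩ U(1⊗1)`), and the line model of ★ `R90S8PlancherelLineModelOfGram` (PB-3∕PB-4) wants that block AS A
CLOSED SPAN OF GENERATORS (`hΘ : closure span {x i} = Sc′`).  THIS FILE supplies the generators.  THEOREMS ONLY (no `def`, no `instance`, no `notation`, no named-fact hypothesis, no `sorry`;
default heartbeats); count-neutral; CLOSES NO SOCKET.

THE MATHEMATICS ([BrockerTomDieck1985] III Thm. (5.10); [DeitmarEchterhoff2014] Prop. 7.3.3; [MoeglinWaldspurger1995] I.2.17, II.1.5, II.2.4).  §1 (generic Hilbert space): if the orthogonal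
projection `P_N` onto `N` maps the closed span `Θ` of a set `G` into itself, then `Θ ⊓ N = closure span (P_N '' G)` — `⊆`: `v = P_N v ∈ P_N(closure span G) ⊆ closure (P_N span G) =
closure span (P_N G)`; `⊇`: `P_N G ⊆ Θ` (stability) and `⊆ N`, both closed.  §2 (U(2,1), κ OF RECORD): `P_τ = ` the orthogonal projection onto the `K_∞`-isotypic component `N_τ` maps the
block of record into itself (★ `starProjection_isotypicComponent_mem'`: `Sc` is closed ★ `isClosed_resGBlock` and `K_∞`-stable ★ `restrict_archInfUnitaryOne_apply_mem_resGBlock`, `χ₂` automorphic),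
so **`Sc ⊓ N_τ = closure span (P_τ '' 𝒢)`**, `𝒢` the generating wave packets `[θ_{f,φ}]` of ★ `resGBlock_def` — for EVERY `K_∞`-representation `τ` (no irreducibility needed here).
* §1 `topologicalClosure_span_inf_eq_of_starProjection_mem` (generic).
* §2 **`resGBlock_inf_isotypicComponent_eq_topologicalClosure_span_image`** (the τ-cut density, structural form).
* §3 `eisensteinSeriesU_pairBrick_rightAverage` — POINTWISE: `θ_{f, ∫c(k)φ(·ι k)}(x) = ∫ c(k)·θ_{f,φ}(x·ι k) dμ_K` (a wave packet is `E(flat(H^{-3}(f∘H)φ, 3))`, ★ C2, so ★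
  `eisensteinSeriesU_flatSectionU_rightAverage` — Fubini under the Godement majorant — applies; `φ` continuous bounded, `H(x·ι k) = H(x)`).
* §4 **`charProj_toLp_pairBrick_eq_toLp`** — IN `L²`: `P_τ[θ_{f,φ}] = [θ_{f, e_τ φ}]`, `e_τ φ := ∫ d_τ·conj χ_τ(k)·φ(·ι k) dμ_K` (★ class bridge `coeFn_charProj_rightRegular_ae_eq`, ★
  `integral_mul_comp_congr_ae`, ★ `quotFun_rightTranslation` with the left `G(F)`-invariance ★ `eisensteinSeriesU_pairRadialSection_quotientSubgroup_mul` (`χ₂` automorphic), §3).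
* §5 κ OF RECORD, `χ₁` UNITARY: `starProjection_isotypicComponent_toLp_pairBrick_eq_toLp` (`P_τ = N_τ.starProjection`, ★ `charProj_eq_starProjection_isotypicComponent`; boundedness of the
  section ★ `exists_bound_of_isChiSectionPair_of_isUnitary`; the averaged section is again a continuous pair section of the same level, ★ (c1)(c2)), and the DESCRIPTIVE τ-cut density
  **`resGBlock_inf_isotypicComponent_eq_topologicalClosure_span_tauAverage`**: `Sc ⊓ N_τ = closure span {[θ_{f, e_τ φ}]}` — the generator family `x` of ★ `R90S8PlancherelLineModelOfGram` (`hΘ`).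
HONEST LABEL: HC_CM is proved only modulo the 7 printed citations (2 remaining named inputs: hLiu418 = `stmt-HodgeConjecture-24832`, h413 = `stmt-HodgeConjecture-24833`) until rung 0
closes; structural binders only (`[SecondCountableTopology K_∞]`, a Haar probability `μK` on `K_∞`, Borel σ-algebra on `K_∞`); REL ≠ ★ ≠ BUILT; this file asserts no named fact and
closes no socket; count-neutral; unconditional.

## References
* [BrockerTomDieck1985] T. Bröcker, T. tom Dieck, *Representations of Compact Lie Groups*, GTM 98 (1985), III Thm. (5.10) (the isotypic projector).
* [DeitmarEchterhoff2014] A. Deitmar, S. Echterhoff, *Principles of Harmonic Analysis* (2nd ed., 2014), Prop. 7.3.3.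
* [MoeglinWaldspurger1995] C. Mœglin, J.-L. Waldspurger, *Spectral Decomposition and Eisenstein Series* (1995), I.2.17, II.1.5, II.2.4 (K-types of pseudo-Eisenstein series).
-/

set_option autoImplicit false
set_option linter.dupNamespace false  -- the mandated namespace `…HodgeConjecture.HodgeConjecture.R90.S8` (LEAD #1 L1) repeats the summit's segment

noncomputable section

open MeasureTheory Measure Set Filter Topology NumberField ContRepresentation
open Literature.NumberTheory Literature.NumberTheory.Automorphic Literature.NumberTheory.Automorphic.UnitaryGroup Literature.NumberTheory.GaloisRepresentations AdelicGroupData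
open Literature.NumberTheory.Automorphic.Arthur2013.Leaves.TECR
open Literature.RepresentationTheory.CompactGroups
open Summit.HodgeConjecture.HodgeConjecture.Cruxes.H413.K2E1BorelEisensteinU
open Summit.HodgeConjecture.HodgeConjecture.Cruxes.H413.K2E1CharacterEisensteinU3PairDefs
open Summit.HodgeConjecture.HodgeConjecture.Cruxes.H413.K2E1ChiSectionSpaceU3PairDefs
open Summit.HodgeConjecture.HodgeConjecture.Cruxes.H413.K2E1ChiPseudoEisensteinRadialCMTwo (comp_borelHeight_mul_eq_flatSectionU continuous_twistedCoeff exists_bound_twistedCoeff)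
open Summit.HodgeConjecture.HodgeConjecture.Cruxes.H413.K2E1PseudoEisensteinKTypeAverageU2 (integral_mul_comp_congr_ae)
open Summit.HodgeConjecture.HodgeConjecture.Cruxes.H413.K2E1MaximalLevelHeckePureTensorBridgeCMTwo (adelicVal_archToAdelic_inclusion_mem_standardMaximalCompactGL)
open scoped ENNReal NNReal InnerProductSpace ComplexConjugate

namespace Summit.HodgeConjecture.HodgeConjecture.R90.S8

/-! ## §1 Generic: the cut of a closed span by a projection that stabilises it -/

section Generic

variable {H : Type*} [NormedAddCommGroup H] [InnerProductSpace ℂ H]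

/-- **THE CUT OF A CLOSED SPAN BY A STABILISING PROJECTION IS THE CLOSED SPAN OF THE PROJECTED GENERATORS**: for a set `G ⊆ H` and a subspace `N` with orthogonal projection `P_N` mapping
`Θ := closure span G` into itself, `Θ ⊓ N = closure span (P_N '' G)`.  (`⊆`: `v = P_N v` lies in `P_N Θ ⊆ closure (P_N (span G)) = closure span (P_N '' G)`; `⊇`: `P_N '' G ⊆ Θ ∩ N`, closed.)
E1 (PB-0′): `G` the generating wave packets of the block of record, `N = N_τ` a `K_∞`-isotypic component. [cite: BrockerTomDieck1985, III Thm. (5.10)] [cite: DeitmarEchterhoff2014, Prop. 7.3.3] -/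
theorem topologicalClosure_span_inf_eq_of_starProjection_mem (G : Set H) (N : Submodule ℂ H) [N.HasOrthogonalProjection]
    (hstab : ∀ v ∈ (Submodule.span ℂ G).topologicalClosure, N.starProjection v ∈ (Submodule.span ℂ G).topologicalClosure) :
    (Submodule.span ℂ G).topologicalClosure ⊓ N = (Submodule.span ℂ (N.starProjection '' G)).topologicalClosure := by
  apply le_antisymm
  · rintro v ⟨hvG, hvN⟩
    have hv : N.starProjection v = v := Submodule.starProjection_eq_self_iff.2 hvN
    rw [← hv]
    have h1 : N.starProjection v ∈ closure (N.starProjection '' (Submodule.span ℂ G : Set H)) :=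
      image_closure_subset_closure_image N.starProjection.continuous ⟨v, by rwa [← Submodule.topologicalClosure_coe], rfl⟩
    have h2 : (N.starProjection : H → H) '' (Submodule.span ℂ G : Set H) ⊆ (Submodule.span ℂ (N.starProjection '' G) : Set H) := by
      rintro _ ⟨w, hw, rfl⟩
      have h3 : N.starProjection.toLinearMap w ∈ (Submodule.span ℂ G).map N.starProjection.toLinearMap := Submodule.mem_map_of_mem hw
      rw [Submodule.map_span] at h3
      exact h3
    show N.starProjection v ∈ ((Submodule.span ℂ (N.starProjection '' G)).topologicalClosure : Set H)
    rw [Submodule.topologicalClosure_coe]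
    exact closure_mono h2 h1
  · refine le_inf ?_ ?_
    · refine Submodule.topologicalClosure_minimal _ (Submodule.span_le.2 ?_) (Submodule.isClosed_topologicalClosure _)
      rintro _ ⟨g, hg, rfl⟩
      exact hstab g (Submodule.le_topologicalClosure _ (Submodule.subset_span hg))
    · refine Submodule.topologicalClosure_minimal _ (Submodule.span_le.2 ?_) ?_
      · rintro _ ⟨g, -, rfl⟩
        exact N.starProjection_apply_mem g
      · rw [← Submodule.orthogonal_orthogonal N]
        exact Submodule.isClosed_orthogonal _

end Generic

/-! ## §2 U(2,1), κ OF RECORD: the τ-cut block is the closed span of the `K_∞`-type projections of the generating wave packets -/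

section Record

variable (L : Type) [Field L] [NumberField L] [IsCMField L]
  (μ : Measure (quasiSplit (↥(maximalRealSubfield L)) L (IsCMField.complexConj L) 3).automorphicQuotient) [(quasiSplit (↥(maximalRealSubfield L)) L (IsCMField.complexConj L) 3).IsAutomorphicMeasure μ]

/-- **THE τ-CUT DENSITY (structural form).**  For the block of record `Sc = resGBlock L μ (ι_f Kf) 1 χ₁ χ₂` (`χ₂` automorphic), `ρ = R ∘ ι_∞|_{K_∞}` (`K_∞ = U(J₃)(L⁺⊗ℝ) ∩ U(1⊗1)`, κ OF RECORD)
and ANY representation `τ` of `K_∞`, with `N_τ` the `τ`-isotypic component of `ρ` and `P_τ` the orthogonal projection onto it: **`Sc ⊓ N_τ = closure span (P_τ '' 𝒢)`**, `𝒢` the generating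
wave packets `[θ_{f,φ}]` of `Sc` (★ `resGBlock_def`).  §1 with the stability `P_τ Sc ⊆ Sc` (★ `starProjection_isotypicComponent_mem'` — `Sc` closed and `K_∞`-stable, ★
`restrict_archInfUnitaryOne_apply_mem_resGBlock`). [cite: BrockerTomDieck1985, III Thm. (5.10)] [cite: MoeglinWaldspurger1995, II.2.4] -/
theorem resGBlock_inf_isotypicComponent_eq_topologicalClosure_span_image
    (Kf : Subgroup ↥(finAdelic (↥(maximalRealSubfield L)) L (IsCMField.complexConj L) 3 ((StdForm.antidiagonal 3).over L))) (χ₁ : HeckeCharacter L)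
    {χ₂ : ↥(TorusDict.torus (IsCMField.complexConj L)) →ₜ* ℂˣ} (hχ₂ : TorusDict.IsAutomorphic (IsCMField.complexConj L) χ₂)
    {W : Type*} [NormedAddCommGroup W] [InnerProductSpace ℂ W] [CompleteSpace W]
    (τ : ContRepresentation ℂ ↥(UnitaryGroup.arch (↥(maximalRealSubfield L)) L (IsCMField.complexConj L) 3 ((StdForm.antidiagonal 3).over L) ⊓
      unitaryGroupOfForm (conjMixed (↥(maximalRealSubfield L)) L (IsCMField.complexConj L)) 1) W) :
    resGBlock L μ (Kf.map (finAdelicToAdelic (↥(maximalRealSubfield L)) L (IsCMField.complexConj L) 3 ((StdForm.antidiagonal 3).over L))) 1 χ₁ χ₂ ⊓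
        ((((quasiSplit (↥(maximalRealSubfield L)) L (IsCMField.complexConj L) 3).rightRegular μ).restrict ((archToAdelic (↥(maximalRealSubfield L)) L (IsCMField.complexConj L) 3 ((StdForm.antidiagonal 3).over L)).comp
          (Subgroup.inclusion (inf_le_left : (UnitaryGroup.arch (↥(maximalRealSubfield L)) L (IsCMField.complexConj L) 3 ((StdForm.antidiagonal 3).over L) ⊓
            unitaryGroupOfForm (conjMixed (↥(maximalRealSubfield L)) L (IsCMField.complexConj L)) 1) ≤ UnitaryGroup.arch (↥(maximalRealSubfield L)) L (IsCMField.complexConj L) 3 ((StdForm.antidiagonal 3).over L))))).isotypicComponent τ).toSubmodule =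
      (Submodule.span ℂ (((((quasiSplit (↥(maximalRealSubfield L)) L (IsCMField.complexConj L) 3).rightRegular μ).restrict ((archToAdelic (↥(maximalRealSubfield L)) L (IsCMField.complexConj L) 3 ((StdForm.antidiagonal 3).over L)).comp
          (Subgroup.inclusion (inf_le_left : (UnitaryGroup.arch (↥(maximalRealSubfield L)) L (IsCMField.complexConj L) 3 ((StdForm.antidiagonal 3).over L) ⊓
            unitaryGroupOfForm (conjMixed (↥(maximalRealSubfield L)) L (IsCMField.complexConj L)) 1) ≤ UnitaryGroup.arch (↥(maximalRealSubfield L)) L (IsCMField.complexConj L) 3 ((StdForm.antidiagonal 3).over L))))).isotypicComponent τ).toSubmodule.starProjection ''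
        {v : (quasiSplit (↥(maximalRealSubfield L)) L (IsCMField.complexConj L) 3).L2 μ |
          ∃ (f : ℝ → ℂ) (_ : Continuous f) (_ : HasCompactSupport f) (_ : tsupport f ⊆ Ioi 0)
            (φ : (quasiSplit (↥(maximalRealSubfield L)) L (IsCMField.complexConj L) 3).Adelic → ℂ)
            (_ : φ ∈ chiSectionSpacePair χ₁ χ₂ (Kf.map (finAdelicToAdelic (↥(maximalRealSubfield L)) L (IsCMField.complexConj L) 3 ((StdForm.antidiagonal 3).over L)))
              ((1 : ↥(Kf.map (finAdelicToAdelic (↥(maximalRealSubfield L)) L (IsCMField.complexConj L) 3 ((StdForm.antidiagonal 3).over L))) →* ℂ) :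
                ↥(Kf.map (finAdelicToAdelic (↥(maximalRealSubfield L)) L (IsCMField.complexConj L) 3 ((StdForm.antidiagonal 3).over L))) → ℂ)) (_ : Continuous φ)
            (hv : MemLp ((quasiSplit (↥(maximalRealSubfield L)) L (IsCMField.complexConj L) 3).quotFun (eisensteinSeriesU (fun g => f (borelHeight g) * φ g))) 2 μ), v = hv.toLp _})).topologicalClosure := by
  have hρ : (((quasiSplit (↥(maximalRealSubfield L)) L (IsCMField.complexConj L) 3).rightRegular μ).restrict ((archToAdelic (↥(maximalRealSubfield L)) L (IsCMField.complexConj L) 3 ((StdForm.antidiagonal 3).over L)).comp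
      (Subgroup.inclusion (inf_le_left : (UnitaryGroup.arch (↥(maximalRealSubfield L)) L (IsCMField.complexConj L) 3 ((StdForm.antidiagonal 3).over L) ⊓
        unitaryGroupOfForm (conjMixed (↥(maximalRealSubfield L)) L (IsCMField.complexConj L)) 1) ≤ UnitaryGroup.arch (↥(maximalRealSubfield L)) L (IsCMField.complexConj L) 3 ((StdForm.antidiagonal 3).over L))))).IsUnitary :=
    fun k => ((quasiSplit (↥(maximalRealSubfield L)) L (IsCMField.complexConj L) 3).isUnitary_rightRegular μ) _
  rw [resGBlock_def]
  refine topologicalClosure_span_inf_eq_of_starProjection_mem _ _ fun v hv => ?_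
  rw [← resGBlock_def] at hv ⊢
  exact starProjection_isotypicComponent_mem' hρ (isClosed_resGBlock L μ _ 1 χ₁ χ₂)
    (fun k w hw => restrict_archInfUnitaryOne_apply_mem_resGBlock L μ Kf χ₁ hχ₂ k hw) hv

end Record

/-! ## §3 Pointwise: the right average of a wave packet is the wave packet of the averaged section -/

section Pointwise

variable (L : Type) [Field L] [NumberField L] [IsCMField L]
  {K : Type*} [TopologicalSpace K] [MeasurableSpace K] [OpensMeasurableSpace K] [CompactSpace K] (μK : Measure K) [IsFiniteMeasure μK]
  (ι : K → (quasiSplit (↥(maximalRealSubfield L)) L (IsCMField.complexConj L) 3).Adelic) (c : K → ℂ)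

/-- **`θ_{f, ∫ c(k)·φ(·ι k)}(x) = ∫ c(k)·θ_{f,φ}(x·ι k) dμ_K`** for `f ∈ C_c((0,∞))` continuous, `φ` continuous bounded, a continuous weight `c` on the compact `K` and `ι(K)` preserving the Borel
height.  The wave packet `θ_{f,ψ} = E((f∘H)·ψ)` IS the Eisenstein series of the flat section of the bounded continuous coefficient `H^{−3}·(f∘H)·ψ` at `z = 3` (★ `comp_borelHeight_mul_eq_flatSectionU`,
★ `continuous_twistedCoeff`, ★ `exists_bound_twistedCoeff`), so ★ `eisensteinSeriesU_flatSectionU_rightAverage` (sum over `B(F)∖G(F)` ⇄ `∫_K`, Fubini under the Godement majorant) applies;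
the coefficient of the averaged section is the average of the coefficient because `H(x·ι k) = H(x)`. [cite: MoeglinWaldspurger1995, II.1.5] [cite: BrockerTomDieck1985, III Thm. (5.10)] -/
theorem eisensteinSeriesU_pairBrick_rightAverage (hι : Continuous ι) (hc : Continuous c)
    (hH : ∀ (x : (quasiSplit (↥(maximalRealSubfield L)) L (IsCMField.complexConj L) 3).Adelic) (k : K), borelHeight (x * ι k) = borelHeight x)
    {f : ℝ → ℂ} (hfc : Continuous f) (hfs : HasCompactSupport f) (hf0 : tsupport f ⊆ Ioi 0)
    {φ : (quasiSplit (↥(maximalRealSubfield L)) L (IsCMField.complexConj L) 3).Adelic → ℂ} (hφc : Continuous φ) {M : ℝ} (hφM : ∀ x, ‖φ x‖ ≤ M)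
    (x : (quasiSplit (↥(maximalRealSubfield L)) L (IsCMField.complexConj L) 3).Adelic) :
    eisensteinSeriesU (fun g : (quasiSplit (↥(maximalRealSubfield L)) L (IsCMField.complexConj L) 3).Adelic => f (borelHeight g : ℝ) * ∫ k, c k * φ (g * ι k) ∂μK) x =
      ∫ k, c k * eisensteinSeriesU (fun g : (quasiSplit (↥(maximalRealSubfield L)) L (IsCMField.complexConj L) 3).Adelic => f (borelHeight g : ℝ) * φ g) (x * ι k) ∂μK := by
  obtain ⟨C, hC⟩ := exists_bound_twistedCoeff (F := ↥(maximalRealSubfield L)) (E := L) (c := IsCMField.complexConj L) (N := 3) hfc hfs hf0 3 hφM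
  have hψc := continuous_twistedCoeff (F := ↥(maximalRealSubfield L)) (E := L) (c := IsCMField.complexConj L) (N := 3) hfc hf0 3 hφc
  have hz : 2 < (((3 : ℝ) : ℂ)).re := by rw [Complex.ofReal_re]; norm_num
  -- the coefficient of the averaged section is the average of the coefficient (`H(y·ι k) = H(y)`)
  have hL : (fun g : (quasiSplit (↥(maximalRealSubfield L)) L (IsCMField.complexConj L) 3).Adelic => f (borelHeight g : ℝ) * ∫ k, c k * φ (g * ι k) ∂μK) =
      flatSectionU (fun y : (quasiSplit (↥(maximalRealSubfield L)) L (IsCMField.complexConj L) 3).Adelic =>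
        ∫ k, c k * (((borelHeight (y * ι k) : ℝ) : ℂ) ^ (-((3 : ℝ) : ℂ)) * f (borelHeight (y * ι k) : ℝ) * φ (y * ι k)) ∂μK) ((3 : ℝ) : ℂ) := by
    rw [comp_borelHeight_mul_eq_flatSectionU f 3]
    congr 1
    funext y
    simp only [hH]
    rw [← integral_const_mul]
    exact integral_congr_ae (Eventually.of_forall fun k => by ring)
  rw [hL, comp_borelHeight_mul_eq_flatSectionU f 3 φ]
  exact eisensteinSeriesU_flatSectionU_rightAverage L μK ι c hι hc hH hz hψc hC x

end Pointwise

/-! ## §4 In `L²`: the `K`-type projection of a wave packet is the wave packet of the `χ_τ`-averaged section -/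

section ClassLevel

variable (L : Type) [Field L] [NumberField L] [IsCMField L]
  (μ : Measure (quasiSplit (↥(maximalRealSubfield L)) L (IsCMField.complexConj L) 3).automorphicQuotient) [(quasiSplit (↥(maximalRealSubfield L)) L (IsCMField.complexConj L) 3).IsAutomorphicMeasure μ]
  {K : Type*} [Group K] [TopologicalSpace K] [IsTopologicalGroup K] [MeasurableSpace K] [BorelSpace K] [CompactSpace K] [SecondCountableTopology K]
  (μK : Measure K) [IsProbabilityMeasure μK] [μK.IsMulLeftInvariant]
  (ι : K →* (quasiSplit (↥(maximalRealSubfield L)) L (IsCMField.complexConj L) 3).Adelic)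

omit [μK.IsMulLeftInvariant] in
/-- **`P_τ[θ_{f,φ}] = [θ_{f, e_τ φ}]` IN `L²`**, `e_τ φ := ∫_K d_τ·conj χ_τ(k)·φ(·ι k) dμ_K`: for a compact second-countable `K` acting through a continuous `ι : K →* G(𝔸)` that preserves the Borel
height, a finite-dimensional continuous `τ`, `χ₂` automorphic (left `G(F)`-invariance of the wave packet ★ `eisensteinSeriesU_pairRadialSection_quotientSubgroup_mul`), `φ` a continuous bounded
`(χ₁, χ₂)`-pair section and `[θ_{f,φ}] ∈ L²`: the character projector ★ `Schur.charProj μK τ (R ∘ ι)` sends `[θ_{f,φ}]` to the (square-integrable) class of `θ_{f, e_τ φ}`.  ★ class bridge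
`coeFn_charProj_rightRegular_ae_eq` (`P_τ f =ᵐ x ↦ ∫ w(k) f(ι(k)⁻¹•x)`), ★ `integral_mul_comp_congr_ae` (replace the representative by `quotFun θ` jointly a.e.), ★ `quotFun_rightTranslation`, §3 at the
point `(out x)⁻¹`. [cite: BrockerTomDieck1985, III Thm. (5.10)] [cite: MoeglinWaldspurger1995, I.2.17, II.1.5] -/
theorem charProj_toLp_pairBrick_eq_toLp (hι : Continuous ι)
    (hH : ∀ (x : (quasiSplit (↥(maximalRealSubfield L)) L (IsCMField.complexConj L) 3).Adelic) (k : K), borelHeight (x * ι k) = borelHeight x)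
    {E : Type*} [NormedAddCommGroup E] [InnerProductSpace ℂ E] [FiniteDimensional ℂ E] (τ : ContRepresentation ℂ K E) (hτc : Continuous (τ : K → E →L[ℂ] E))
    {χ₁ : HeckeCharacter L} {χ₂ : ↥(TorusDict.torus (IsCMField.complexConj L)) →ₜ* ℂˣ} (hχ₂ : TorusDict.IsAutomorphic (IsCMField.complexConj L) χ₂)
    {f : ℝ → ℂ} (hfc : Continuous f) (hfs : HasCompactSupport f) (hf0 : tsupport f ⊆ Ioi 0)
    {φ : (quasiSplit (↥(maximalRealSubfield L)) L (IsCMField.complexConj L) 3).Adelic → ℂ} (hφ : IsChiSectionPair χ₁ χ₂ φ) (hφc : Continuous φ) {M : ℝ} (hφM : ∀ x, ‖φ x‖ ≤ M)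
    (hv : MemLp ((quasiSplit (↥(maximalRealSubfield L)) L (IsCMField.complexConj L) 3).quotFun
      (eisensteinSeriesU (fun g : (quasiSplit (↥(maximalRealSubfield L)) L (IsCMField.complexConj L) 3).Adelic => f (borelHeight g : ℝ) * φ g))) 2 μ) :
    ∃ hv' : MemLp ((quasiSplit (↥(maximalRealSubfield L)) L (IsCMField.complexConj L) 3).quotFun
        (eisensteinSeriesU (fun g : (quasiSplit (↥(maximalRealSubfield L)) L (IsCMField.complexConj L) 3).Adelic =>
          f (borelHeight g : ℝ) * ∫ k, ((Module.finrank ℂ E : ℂ) * conj (Schur.character τ k)) * φ (g * ι k) ∂μK))) 2 μ,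
      Schur.charProj μK τ (((quasiSplit (↥(maximalRealSubfield L)) L (IsCMField.complexConj L) 3).rightRegular μ).restrict ι) (hv.toLp _) = hv'.toLp _ := by
  letI : MeasurableSpace (quasiSplit (↥(maximalRealSubfield L)) L (IsCMField.complexConj L) 3).Adelic := borel _
  haveI : BorelSpace (quasiSplit (↥(maximalRealSubfield L)) L (IsCMField.complexConj L) 3).Adelic := ⟨rfl⟩
  haveI : SecondCountableTopology (quasiSplit (↥(maximalRealSubfield L)) L (IsCMField.complexConj L) 3).Adelic :=
    secondCountableTopology_cmDatum_Adelic L 3 ((StdForm.antidiagonal 3).over L)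
  set w : K → ℂ := fun k => (Module.finrank ℂ E : ℂ) * conj (Schur.character τ k) with hw_def
  have hw : Continuous w := continuous_const.mul (Complex.continuous_conj.comp (Schur.continuous_character hτc))
  set θ : (quasiSplit (↥(maximalRealSubfield L)) L (IsCMField.complexConj L) 3).Adelic → ℂ :=
    eisensteinSeriesU (fun g : (quasiSplit (↥(maximalRealSubfield L)) L (IsCMField.complexConj L) 3).Adelic => f (borelHeight g : ℝ) * φ g) with hθ
  set θ' : (quasiSplit (↥(maximalRealSubfield L)) L (IsCMField.complexConj L) 3).Adelic → ℂ :=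
    eisensteinSeriesU (fun g : (quasiSplit (↥(maximalRealSubfield L)) L (IsCMField.complexConj L) 3).Adelic => f (borelHeight g : ℝ) * ∫ k, w k * φ (g * ι k) ∂μK) with hθ'
  -- (1) the class bridge and (2) the a.e. transport of the representative
  have h1 := coeFn_charProj_rightRegular_ae_eq L μ μK ι hι τ hτc (hv.toLp _)
  have h2 := integral_mul_comp_congr_ae (quasiSplit (↥(maximalRealSubfield L)) L (IsCMField.complexConj L) 3) μ μK (ι := ι) hι.measurable hv.coeFn_toLp w
  -- (3) pointwise: `∫ w(k)·quotFun θ (ι(k)⁻¹ • x) = quotFun θ' x`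
  have hinv := eisensteinSeriesU_pairRadialSection_quotientSubgroup_mul L hφ hχ₂ f
  have h3 : ∀ x : (quasiSplit (↥(maximalRealSubfield L)) L (IsCMField.complexConj L) 3).automorphicQuotient,
      (∫ k, w k * (quasiSplit (↥(maximalRealSubfield L)) L (IsCMField.complexConj L) 3).quotFun θ ((ι k)⁻¹ • x) ∂μK) =
        (quasiSplit (↥(maximalRealSubfield L)) L (IsCMField.complexConj L) 3).quotFun θ' x := fun x => by
    have hq : ∀ k : K, (quasiSplit (↥(maximalRealSubfield L)) L (IsCMField.complexConj L) 3).quotFun θ ((ι k)⁻¹ • x) =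
        θ ((Quotient.out (x : (quasiSplit (↥(maximalRealSubfield L)) L (IsCMField.complexConj L) 3).Adelic ⧸
          (quasiSplit (↥(maximalRealSubfield L)) L (IsCMField.complexConj L) 3).quotientSubgroup))⁻¹ * ι k) := fun k => by
      rw [← congrFun (AdelicGroupData.quotFun_rightTranslation hinv (ι k)) x]
      rfl
    simp_rw [hq]
    exact (eisensteinSeriesU_pairBrick_rightAverage L μK ι w hι hw hH hfc hfs hf0 hφc hφM _).symm
  have hae : ((Schur.charProj μK τ (((quasiSplit (↥(maximalRealSubfield L)) L (IsCMField.complexConj L) 3).rightRegular μ).restrict ι) (hv.toLp _) :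
      (quasiSplit (↥(maximalRealSubfield L)) L (IsCMField.complexConj L) 3).L2 μ) : (quasiSplit (↥(maximalRealSubfield L)) L (IsCMField.complexConj L) 3).automorphicQuotient → ℂ) =ᵐ[μ]
      (quasiSplit (↥(maximalRealSubfield L)) L (IsCMField.complexConj L) 3).quotFun θ' :=
    h1.trans (h2.trans (Eventually.of_forall h3))
  exact ⟨(Lp.memLp _).ae_eq hae, Lp.ext (hae.trans (MemLp.coeFn_toLp _).symm)⟩

end ClassLevel

/-! ## §5 κ OF RECORD, `χ₁` unitary: the τ-cut block is the closed span of the wave packets of the `χ_τ`-averaged sections -/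

section RecordDescriptive

variable (L : Type) [Field L] [NumberField L] [IsCMField L]
  (μ : Measure (quasiSplit (↥(maximalRealSubfield L)) L (IsCMField.complexConj L) 3).automorphicQuotient) [(quasiSplit (↥(maximalRealSubfield L)) L (IsCMField.complexConj L) 3).IsAutomorphicMeasure μ]
  [MeasurableSpace ↥(UnitaryGroup.arch (↥(maximalRealSubfield L)) L (IsCMField.complexConj L) 3 ((StdForm.antidiagonal 3).over L) ⊓ unitaryGroupOfForm (conjMixed (↥(maximalRealSubfield L)) L (IsCMField.complexConj L)) 1)]
  [BorelSpace ↥(UnitaryGroup.arch (↥(maximalRealSubfield L)) L (IsCMField.complexConj L) 3 ((StdForm.antidiagonal 3).over L) ⊓ unitaryGroupOfForm (conjMixed (↥(maximalRealSubfield L)) L (IsCMField.complexConj L)) 1)]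
  [SecondCountableTopology ↥(UnitaryGroup.arch (↥(maximalRealSubfield L)) L (IsCMField.complexConj L) 3 ((StdForm.antidiagonal 3).over L) ⊓ unitaryGroupOfForm (conjMixed (↥(maximalRealSubfield L)) L (IsCMField.complexConj L)) 1)]
  (μK : Measure ↥(UnitaryGroup.arch (↥(maximalRealSubfield L)) L (IsCMField.complexConj L) 3 ((StdForm.antidiagonal 3).over L) ⊓ unitaryGroupOfForm (conjMixed (↥(maximalRealSubfield L)) L (IsCMField.complexConj L)) 1))
  [IsProbabilityMeasure μK] [μK.IsMulLeftInvariant]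

/-- **`P_τ[θ_{f,φ}] = [θ_{f, e_τ φ}]` AT THE κ OF RECORD**, `P_τ` = the orthogonal projection onto the `τ`-isotypic component `N_τ` of `ρ = R ∘ ι_∞|_{K_∞}` (`K_∞ = U(J₃)(L⁺⊗ℝ) ∩ U(1⊗1)`), `τ`
irreducible unitary: `P_τ = charProj` (★ `charProj_eq_starProjection_isotypicComponent`, `R` unitary strongly continuous), `ι_∞(K_∞)` preserves the Borel height (★
`adelicVal_archToAdelic_inclusion_mem_standardMaximalCompactGL`, ★ `borelHeight_mul_of_mem_comap_standardMaximalCompactGL`), `K_∞` compact (★ `compactSpace_arch_inf_unitaryOne`), the section is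
bounded (★ `exists_bound_of_isChiSectionPair_of_isUnitary`, `χ₁` unitary, `χ₂` automorphic) — §4. [cite: BrockerTomDieck1985, III Thm. (5.10)] [cite: MoeglinWaldspurger1995, I.2.17, II.1.5, II.2.4] -/
theorem starProjection_isotypicComponent_toLp_pairBrick_eq_toLp
    {E : Type*} [NormedAddCommGroup E] [InnerProductSpace ℂ E] [FiniteDimensional ℂ E]
    (τ : ContRepresentation ℂ ↥(UnitaryGroup.arch (↥(maximalRealSubfield L)) L (IsCMField.complexConj L) 3 ((StdForm.antidiagonal 3).over L) ⊓ unitaryGroupOfForm (conjMixed (↥(maximalRealSubfield L)) L (IsCMField.complexConj L)) 1) E)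
    (hτc : Continuous (τ : ↥(UnitaryGroup.arch (↥(maximalRealSubfield L)) L (IsCMField.complexConj L) 3 ((StdForm.antidiagonal 3).over L) ⊓ unitaryGroupOfForm (conjMixed (↥(maximalRealSubfield L)) L (IsCMField.complexConj L)) 1) → E →L[ℂ] E))
    [τ.toRepresentation.IsIrreducible]
    (hτu : ∀ (g : ↥(UnitaryGroup.arch (↥(maximalRealSubfield L)) L (IsCMField.complexConj L) 3 ((StdForm.antidiagonal 3).over L) ⊓ unitaryGroupOfForm (conjMixed (↥(maximalRealSubfield L)) L (IsCMField.complexConj L)) 1)) (x y : E), ⟪τ g x, τ g y⟫_ℂ = ⟪x, y⟫_ℂ)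
    {χ₁ : HeckeCharacter L} (hχ₁ : χ₁.IsUnitary) {χ₂ : ↥(TorusDict.torus (IsCMField.complexConj L)) →ₜ* ℂˣ} (hχ₂ : TorusDict.IsAutomorphic (IsCMField.complexConj L) χ₂)
    {f : ℝ → ℂ} (hfc : Continuous f) (hfs : HasCompactSupport f) (hf0 : tsupport f ⊆ Ioi 0)
    {φ : (quasiSplit (↥(maximalRealSubfield L)) L (IsCMField.complexConj L) 3).Adelic → ℂ} (hφ : IsChiSectionPair χ₁ χ₂ φ) (hφc : Continuous φ)
    (hv : MemLp ((quasiSplit (↥(maximalRealSubfield L)) L (IsCMField.complexConj L) 3).quotFun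
      (eisensteinSeriesU (fun g : (quasiSplit (↥(maximalRealSubfield L)) L (IsCMField.complexConj L) 3).Adelic => f (borelHeight g : ℝ) * φ g))) 2 μ) :
    ∃ hv' : MemLp ((quasiSplit (↥(maximalRealSubfield L)) L (IsCMField.complexConj L) 3).quotFun
        (eisensteinSeriesU (fun g : (quasiSplit (↥(maximalRealSubfield L)) L (IsCMField.complexConj L) 3).Adelic =>
          f (borelHeight g : ℝ) * ∫ k, ((Module.finrank ℂ E : ℂ) * conj (Schur.character τ k)) *
            φ (g * (archToAdelic (↥(maximalRealSubfield L)) L (IsCMField.complexConj L) 3 ((StdForm.antidiagonal 3).over L)).comp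
              (Subgroup.inclusion (inf_le_left : (UnitaryGroup.arch (↥(maximalRealSubfield L)) L (IsCMField.complexConj L) 3 ((StdForm.antidiagonal 3).over L) ⊓
                unitaryGroupOfForm (conjMixed (↥(maximalRealSubfield L)) L (IsCMField.complexConj L)) 1) ≤ UnitaryGroup.arch (↥(maximalRealSubfield L)) L (IsCMField.complexConj L) 3 ((StdForm.antidiagonal 3).over L))) k) ∂μK))) 2 μ,
      ((((quasiSplit (↥(maximalRealSubfield L)) L (IsCMField.complexConj L) 3).rightRegular μ).restrict ((archToAdelic (↥(maximalRealSubfield L)) L (IsCMField.complexConj L) 3 ((StdForm.antidiagonal 3).over L)).comp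
          (Subgroup.inclusion (inf_le_left : (UnitaryGroup.arch (↥(maximalRealSubfield L)) L (IsCMField.complexConj L) 3 ((StdForm.antidiagonal 3).over L) ⊓
            unitaryGroupOfForm (conjMixed (↥(maximalRealSubfield L)) L (IsCMField.complexConj L)) 1) ≤ UnitaryGroup.arch (↥(maximalRealSubfield L)) L (IsCMField.complexConj L) 3 ((StdForm.antidiagonal 3).over L))))).isotypicComponent τ).toSubmodule.starProjection
        (hv.toLp _) = hv'.toLp _ := by
  haveI : CompactSpace ↥(UnitaryGroup.arch (↥(maximalRealSubfield L)) L (IsCMField.complexConj L) 3 ((StdForm.antidiagonal 3).over L) ⊓ unitaryGroupOfForm (conjMixed (↥(maximalRealSubfield L)) L (IsCMField.complexConj L)) 1) :=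
    compactSpace_arch_inf_unitaryOne L 3 ((StdForm.antidiagonal 3).over L)
  have hU := (quasiSplit (↥(maximalRealSubfield L)) L (IsCMField.complexConj L) 3).isUnitary_rightRegular μ
  have hS := (quasiSplit (↥(maximalRealSubfield L)) L (IsCMField.complexConj L) 3).isStronglyContinuous_rightRegular_holds μ
  have hκc := continuous_inclusion_arch_inf_unitaryOne L 3 ((StdForm.antidiagonal 3).over L)
  have hιc : Continuous ((archToAdelic (↥(maximalRealSubfield L)) L (IsCMField.complexConj L) 3 ((StdForm.antidiagonal 3).over L)).comp
      (Subgroup.inclusion (inf_le_left : (UnitaryGroup.arch (↥(maximalRealSubfield L)) L (IsCMField.complexConj L) 3 ((StdForm.antidiagonal 3).over L) ⊓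
        unitaryGroupOfForm (conjMixed (↥(maximalRealSubfield L)) L (IsCMField.complexConj L)) 1) ≤ UnitaryGroup.arch (↥(maximalRealSubfield L)) L (IsCMField.complexConj L) 3 ((StdForm.antidiagonal 3).over L)))) :=
    (continuous_archToAdelic (↥(maximalRealSubfield L)) L (IsCMField.complexConj L) 3 ((StdForm.antidiagonal 3).over L)).comp hκc
  have hH : ∀ (x : (quasiSplit (↥(maximalRealSubfield L)) L (IsCMField.complexConj L) 3).Adelic)
      (k : ↥(UnitaryGroup.arch (↥(maximalRealSubfield L)) L (IsCMField.complexConj L) 3 ((StdForm.antidiagonal 3).over L) ⊓ unitaryGroupOfForm (conjMixed (↥(maximalRealSubfield L)) L (IsCMField.complexConj L)) 1)),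
      borelHeight (x * (archToAdelic (↥(maximalRealSubfield L)) L (IsCMField.complexConj L) 3 ((StdForm.antidiagonal 3).over L)).comp
        (Subgroup.inclusion (inf_le_left : (UnitaryGroup.arch (↥(maximalRealSubfield L)) L (IsCMField.complexConj L) 3 ((StdForm.antidiagonal 3).over L) ⊓
          unitaryGroupOfForm (conjMixed (↥(maximalRealSubfield L)) L (IsCMField.complexConj L)) 1) ≤ UnitaryGroup.arch (↥(maximalRealSubfield L)) L (IsCMField.complexConj L) 3 ((StdForm.antidiagonal 3).over L))) k) =
        borelHeight x := fun x k =>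
    borelHeight_mul_of_mem_comap_standardMaximalCompactGL (Subgroup.mem_comap.2 (adelicVal_archToAdelic_inclusion_mem_standardMaximalCompactGL k)) x
  obtain ⟨M, hφM⟩ := exists_bound_of_isChiSectionPair_of_isUnitary L hχ₁ hχ₂ hφ hφc
  obtain ⟨hv', h⟩ := charProj_toLp_pairBrick_eq_toLp L μ μK ((archToAdelic (↥(maximalRealSubfield L)) L (IsCMField.complexConj L) 3 ((StdForm.antidiagonal 3).over L)).comp
      (Subgroup.inclusion (inf_le_left : (UnitaryGroup.arch (↥(maximalRealSubfield L)) L (IsCMField.complexConj L) 3 ((StdForm.antidiagonal 3).over L) ⊓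
        unitaryGroupOfForm (conjMixed (↥(maximalRealSubfield L)) L (IsCMField.complexConj L)) 1) ≤ UnitaryGroup.arch (↥(maximalRealSubfield L)) L (IsCMField.complexConj L) 3 ((StdForm.antidiagonal 3).over L))))
    hιc hH τ hτc hχ₂ hfc hfs hf0 hφ hφc hφM hv
  exact ⟨hv', (charProj_eq_starProjection_isotypicComponent μK
    (π := (((quasiSplit (↥(maximalRealSubfield L)) L (IsCMField.complexConj L) 3).rightRegular μ).restrict ((archToAdelic (↥(maximalRealSubfield L)) L (IsCMField.complexConj L) 3 ((StdForm.antidiagonal 3).over L)).comp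
      (Subgroup.inclusion (inf_le_left : (UnitaryGroup.arch (↥(maximalRealSubfield L)) L (IsCMField.complexConj L) 3 ((StdForm.antidiagonal 3).over L) ⊓
        unitaryGroupOfForm (conjMixed (↥(maximalRealSubfield L)) L (IsCMField.complexConj L)) 1) ≤ UnitaryGroup.arch (↥(maximalRealSubfield L)) L (IsCMField.complexConj L) 3 ((StdForm.antidiagonal 3).over L))))))
    (fun w => (hS w).comp hιc) (fun k => hU _) hτc hτu _).symm.trans h⟩

/-- **THE τ-CUT DENSITY (descriptive form), `χ₁` unitary, `χ₂` automorphic, `τ` an irreducible unitary `K_∞`-type**: the τ-cut block of record is the closed span of the wave packets of the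
`χ_τ`-AVERAGED sections, **`Sc ⊓ N_τ = closure span {[θ_{f, e_τ φ}] : (f, φ) a generator of Sc}`**, `e_τ φ = ∫_{K_∞} d_τ·conj χ_τ(k)·φ(·ι_∞ k) dμ_K` (the generating set carries both
square-integrability witnesses; `e_τ φ` is again a continuous `(χ₁, χ₂)`-pair section of level `ι_f Kf` by ★ `mem_chiSectionSpacePair_rightAverage` ∕ ★ `continuous_rightAverage` with ★
`commute_archToAdelic_finAdelicToAdelic`).  This is the generator family `x` (`hΘ : closure span {x i} = Sc_τ`) of ★ `R90S8PlancherelLineModelOfGram`: §2 + §5 (the image of a generator IS the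
wave packet of the averaged section). [cite: BrockerTomDieck1985, III Thm. (5.10)] [cite: MoeglinWaldspurger1995, I.2.17, II.1.5, II.2.4] -/
theorem resGBlock_inf_isotypicComponent_eq_topologicalClosure_span_tauAverage
    (Kf : Subgroup ↥(finAdelic (↥(maximalRealSubfield L)) L (IsCMField.complexConj L) 3 ((StdForm.antidiagonal 3).over L)))
    {E : Type*} [NormedAddCommGroup E] [InnerProductSpace ℂ E] [FiniteDimensional ℂ E]
    (τ : ContRepresentation ℂ ↥(UnitaryGroup.arch (↥(maximalRealSubfield L)) L (IsCMField.complexConj L) 3 ((StdForm.antidiagonal 3).over L) ⊓ unitaryGroupOfForm (conjMixed (↥(maximalRealSubfield L)) L (IsCMField.complexConj L)) 1) E) (hτc : Continuous (τ : ↥(UnitaryGroup.arch (↥(maximalRealSubfield L)) L (IsCMField.complexConj L) 3 ((StdForm.antidiagonal 3).over L) ⊓ unitaryGroupOfForm (conjMixed (↥(maximalRealSubfield L)) L (IsCMField.complexConj L)) 1) → E →L[ℂ] E)) [τ.toRepresentation.IsIrreducible]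
    (hτu : ∀ (g : ↥(UnitaryGroup.arch (↥(maximalRealSubfield L)) L (IsCMField.complexConj L) 3 ((StdForm.antidiagonal 3).over L) ⊓ unitaryGroupOfForm (conjMixed (↥(maximalRealSubfield L)) L (IsCMField.complexConj L)) 1)) (x y : E), ⟪τ g x, τ g y⟫_ℂ = ⟪x, y⟫_ℂ)
    {χ₁ : HeckeCharacter L} (hχ₁ : χ₁.IsUnitary) {χ₂ : ↥(TorusDict.torus (IsCMField.complexConj L)) →ₜ* ℂˣ} (hχ₂ : TorusDict.IsAutomorphic (IsCMField.complexConj L) χ₂) :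
    resGBlock L μ (Kf.map (finAdelicToAdelic (↥(maximalRealSubfield L)) L (IsCMField.complexConj L) 3 ((StdForm.antidiagonal 3).over L))) 1 χ₁ χ₂ ⊓ ((((quasiSplit (↥(maximalRealSubfield L)) L (IsCMField.complexConj L) 3).rightRegular μ).restrict ((archToAdelic (↥(maximalRealSubfield L)) L (IsCMField.complexConj L) 3 ((StdForm.antidiagonal 3).over L)).comp
              (Subgroup.inclusion (inf_le_left : (UnitaryGroup.arch (↥(maximalRealSubfield L)) L (IsCMField.complexConj L) 3 ((StdForm.antidiagonal 3).over L) ⊓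
                unitaryGroupOfForm (conjMixed (↥(maximalRealSubfield L)) L (IsCMField.complexConj L)) 1) ≤ UnitaryGroup.arch (↥(maximalRealSubfield L)) L (IsCMField.complexConj L) 3 ((StdForm.antidiagonal 3).over L))))).isotypicComponent τ).toSubmodule =
      (Submodule.span ℂ {v : (quasiSplit (↥(maximalRealSubfield L)) L (IsCMField.complexConj L) 3).L2 μ |
          ∃ (f : ℝ → ℂ) (_ : Continuous f) (_ : HasCompactSupport f) (_ : tsupport f ⊆ Ioi 0)
            (φ : (quasiSplit (↥(maximalRealSubfield L)) L (IsCMField.complexConj L) 3).Adelic → ℂ)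
            (_ : φ ∈ chiSectionSpacePair χ₁ χ₂ (Kf.map (finAdelicToAdelic (↥(maximalRealSubfield L)) L (IsCMField.complexConj L) 3 ((StdForm.antidiagonal 3).over L))) ((1 : ↥(Kf.map (finAdelicToAdelic (↥(maximalRealSubfield L)) L (IsCMField.complexConj L) 3 ((StdForm.antidiagonal 3).over L))) →* ℂ) : ↥(Kf.map (finAdelicToAdelic (↥(maximalRealSubfield L)) L (IsCMField.complexConj L) 3 ((StdForm.antidiagonal 3).over L))) → ℂ)) (_ : Continuous φ)
            (_ : MemLp ((quasiSplit (↥(maximalRealSubfield L)) L (IsCMField.complexConj L) 3).quotFun (eisensteinSeriesU (fun g => f (borelHeight g) * φ g))) 2 μ)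
            (hv' : MemLp ((quasiSplit (↥(maximalRealSubfield L)) L (IsCMField.complexConj L) 3).quotFun (eisensteinSeriesU (fun g : (quasiSplit (↥(maximalRealSubfield L)) L (IsCMField.complexConj L) 3).Adelic =>
              f (borelHeight g : ℝ) * ∫ k, ((Module.finrank ℂ E : ℂ) * conj (Schur.character τ k)) * φ (g * ((archToAdelic (↥(maximalRealSubfield L)) L (IsCMField.complexConj L) 3 ((StdForm.antidiagonal 3).over L)).comp
              (Subgroup.inclusion (inf_le_left : (UnitaryGroup.arch (↥(maximalRealSubfield L)) L (IsCMField.complexConj L) 3 ((StdForm.antidiagonal 3).over L) ⊓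
                unitaryGroupOfForm (conjMixed (↥(maximalRealSubfield L)) L (IsCMField.complexConj L)) 1) ≤ UnitaryGroup.arch (↥(maximalRealSubfield L)) L (IsCMField.complexConj L) 3 ((StdForm.antidiagonal 3).over L)))) k) ∂μK))) 2 μ), v = hv'.toLp _}).topologicalClosure := by
  rw [resGBlock_inf_isotypicComponent_eq_topologicalClosure_span_image L μ Kf χ₁ hχ₂ τ]
  have hset : ((((quasiSplit (↥(maximalRealSubfield L)) L (IsCMField.complexConj L) 3).rightRegular μ).restrict ((archToAdelic (↥(maximalRealSubfield L)) L (IsCMField.complexConj L) 3 ((StdForm.antidiagonal 3).over L)).comp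
              (Subgroup.inclusion (inf_le_left : (UnitaryGroup.arch (↥(maximalRealSubfield L)) L (IsCMField.complexConj L) 3 ((StdForm.antidiagonal 3).over L) ⊓
                unitaryGroupOfForm (conjMixed (↥(maximalRealSubfield L)) L (IsCMField.complexConj L)) 1) ≤ UnitaryGroup.arch (↥(maximalRealSubfield L)) L (IsCMField.complexConj L) 3 ((StdForm.antidiagonal 3).over L))))).isotypicComponent τ).toSubmodule.starProjection ''
      {v : (quasiSplit (↥(maximalRealSubfield L)) L (IsCMField.complexConj L) 3).L2 μ |
        ∃ (f : ℝ → ℂ) (_ : Continuous f) (_ : HasCompactSupport f) (_ : tsupport f ⊆ Ioi 0)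
          (φ : (quasiSplit (↥(maximalRealSubfield L)) L (IsCMField.complexConj L) 3).Adelic → ℂ)
          (_ : φ ∈ chiSectionSpacePair χ₁ χ₂ (Kf.map (finAdelicToAdelic (↥(maximalRealSubfield L)) L (IsCMField.complexConj L) 3 ((StdForm.antidiagonal 3).over L))) ((1 : ↥(Kf.map (finAdelicToAdelic (↥(maximalRealSubfield L)) L (IsCMField.complexConj L) 3 ((StdForm.antidiagonal 3).over L))) →* ℂ) : ↥(Kf.map (finAdelicToAdelic (↥(maximalRealSubfield L)) L (IsCMField.complexConj L) 3 ((StdForm.antidiagonal 3).over L))) → ℂ)) (_ : Continuous φ)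
          (hv : MemLp ((quasiSplit (↥(maximalRealSubfield L)) L (IsCMField.complexConj L) 3).quotFun (eisensteinSeriesU (fun g => f (borelHeight g) * φ g))) 2 μ), v = hv.toLp _} =
      {v : (quasiSplit (↥(maximalRealSubfield L)) L (IsCMField.complexConj L) 3).L2 μ |
        ∃ (f : ℝ → ℂ) (_ : Continuous f) (_ : HasCompactSupport f) (_ : tsupport f ⊆ Ioi 0)
          (φ : (quasiSplit (↥(maximalRealSubfield L)) L (IsCMField.complexConj L) 3).Adelic → ℂ)
          (_ : φ ∈ chiSectionSpacePair χ₁ χ₂ (Kf.map (finAdelicToAdelic (↥(maximalRealSubfield L)) L (IsCMField.complexConj L) 3 ((StdForm.antidiagonal 3).over L))) ((1 : ↥(Kf.map (finAdelicToAdelic (↥(maximalRealSubfield L)) L (IsCMField.complexConj L) 3 ((StdForm.antidiagonal 3).over L))) →* ℂ) : ↥(Kf.map (finAdelicToAdelic (↥(maximalRealSubfield L)) L (IsCMField.complexConj L) 3 ((StdForm.antidiagonal 3).over L))) → ℂ)) (_ : Continuous φ)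
          (_ : MemLp ((quasiSplit (↥(maximalRealSubfield L)) L (IsCMField.complexConj L) 3).quotFun (eisensteinSeriesU (fun g => f (borelHeight g) * φ g))) 2 μ)
          (hv' : MemLp ((quasiSplit (↥(maximalRealSubfield L)) L (IsCMField.complexConj L) 3).quotFun (eisensteinSeriesU (fun g : (quasiSplit (↥(maximalRealSubfield L)) L (IsCMField.complexConj L) 3).Adelic =>
            f (borelHeight g : ℝ) * ∫ k, ((Module.finrank ℂ E : ℂ) * conj (Schur.character τ k)) * φ (g * ((archToAdelic (↥(maximalRealSubfield L)) L (IsCMField.complexConj L) 3 ((StdForm.antidiagonal 3).over L)).comp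
              (Subgroup.inclusion (inf_le_left : (UnitaryGroup.arch (↥(maximalRealSubfield L)) L (IsCMField.complexConj L) 3 ((StdForm.antidiagonal 3).over L) ⊓
                unitaryGroupOfForm (conjMixed (↥(maximalRealSubfield L)) L (IsCMField.complexConj L)) 1) ≤ UnitaryGroup.arch (↥(maximalRealSubfield L)) L (IsCMField.complexConj L) 3 ((StdForm.antidiagonal 3).over L)))) k) ∂μK))) 2 μ), v = hv'.toLp _} := by
    ext v
    constructor
    · rintro ⟨u, ⟨f, hfc, hfs, hf0, φ, hφV, hφc, hu, rfl⟩, rfl⟩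
      obtain ⟨hv', h⟩ := starProjection_isotypicComponent_toLp_pairBrick_eq_toLp L μ μK τ hτc hτu hχ₁ hχ₂ hfc hfs hf0 (isChiSectionPair_of_mem hφV) hφc hu
      exact ⟨f, hfc, hfs, hf0, φ, hφV, hφc, hu, hv', h⟩
    · rintro ⟨f, hfc, hfs, hf0, φ, hφV, hφc, hu, hv', rfl⟩
      obtain ⟨hv'', h⟩ := starProjection_isotypicComponent_toLp_pairBrick_eq_toLp L μ μK τ hτc hτu hχ₁ hχ₂ hfc hfs hf0 (isChiSectionPair_of_mem hφV) hφc hu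
      exact ⟨hu.toLp _, ⟨f, hfc, hfs, hf0, φ, hφV, hφc, hu, rfl⟩, h⟩
  rw [hset]

end RecordDescriptive

end Summit.HodgeConjecture.HodgeConjecture.R90.S8

end
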